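import Mathlib
import HarnessLib

/-!
# Weil-type ladder · prover 3, generation 52 — the character lemma behind the SYMMETRY CRITERION (ANCHOR.md 3.6)

b2b cell `hweil`, report `b2b-hweil-pv3-g52/ANCHOR.md` §3.6 / §4.  Helper file `--supports stmt-HodgeConjecture-2524`; closes nothing; no case of
the Hodge conjecture is claimed.  HONEST LABEL: finite combinatorics (`decide`), Mathlib only, no definition, no named fact, no `sorry`; the
Hodge-theoretic wrapper is pen-and-paper in the report; 0 unconditional rungs above the floor; Markman-free.

## Context (not kernel content)

On `P₀ = E⁶`, `E = ℂ/ℤ[ζ₃]`, a monomial `dz_S ∧ dz̄_T` of `H⁶(E⁶)` of Hodge type `(3,3)` has a CHARACTER `e ∈ {−1,0,1}⁶` under the factorwise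
action of `μ₃⁶ ⊂ Aut(E,0)⁶` (`e_j = +1`, `−1`, `0` according as factor `j` contributes `dz_j`, `dz̄_j`, or nothing/both), BALANCED (`#{+1} = #{−1}`).
The Weil plane `W_K` of `ψ₀ = (α,α,α,−α,−α,−α)` has characters `±v₀`, `v₀ = (1,1,1,−1,−1,−1)`, and the classes `η_S` have character `0`.  For the
group `Γ = {ν ∈ μ₃⁶ : ν₁ν₂ν₃ = 1 = ν₄ν₅ν₆}` (resp. the minimal `Γ′ = {ν₁ν₂ν₃ = 1, ν₄ν₆ = 1, ν₅ = 1}`) a character is trivial iff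
`e ≡ (a,a,a,b,b,b)` (resp. `(a,a,a,b,c,b)`) `mod 3`.  The two theorems below say that the only balanced such `e` are `0, ±v₀` — i.e.
`H^{3,3}(E⁶, ℚ)^Γ = ⊕ ℚη_S ⊕ W_K`: every Γ-invariant Hodge class (e.g. `c₃` of Γ-symmetric bundle data, THEOREM DL) has no component outside
`⊕ℚη_S ⊕ W_K`.  Encoding: residues `mod 3` as `Fin 3` (`0 ↦ 0`, `+1 ↦ 1`, `−1 ↦ 2`), so `v₀ = ![1,1,1,2,2,2]` and `−v₀ = ![2,2,2,1,1,1]`.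

* `weilCharacter_of_blockConstant` — the `(ℤ/3)⁴` case.
* `weilCharacter_of_blockConstant'` — the minimal `(ℤ/3)³` case (factor 5 free).

[folklore] (character bookkeeping; the search showing that no subgroup of `μ₆⁶` of order `< 27` works is `code/pv3-g52/symmetry.py`.)
-/

set_option linter.dupNamespace false

namespace Summit.HodgeConjecture.HodgeConjecture.WeilTypeLadder

/-- **Character lemma, `Γ = (ℤ/3)⁴`.** A balanced vector `e : Fin 6 → Fin 3` (as many entries `1` as entries `2`) that is constant on the
block `{0,1,2}` and constant on the block `{3,4,5}` is `0`, `v₀ = (1,1,1,2,2,2)` or `−v₀ = (2,2,2,1,1,1)`. [folklore] -/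
theorem weilCharacter_of_blockConstant (e : Fin 6 → Fin 3)
    (hbal : (Finset.univ.filter fun i => e i = 1).card = (Finset.univ.filter fun i => e i = 2).card)
    (h01 : e 0 = e 1) (h12 : e 1 = e 2) (h34 : e 3 = e 4) (h45 : e 4 = e 5) :
    e = ![0, 0, 0, 0, 0, 0] ∨ e = ![1, 1, 1, 2, 2, 2] ∨ e = ![2, 2, 2, 1, 1, 1] := by
  have he : e = ![e 0, e 0, e 0, e 3, e 3, e 3] := by
    funext i
    fin_cases i
    · simp
    · simp [← h01]
    · simp [← h12, ← h01]
    · simp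
    · simp [← h34]
    · simp [← h45, ← h34]
  rw [he] at hbal ⊢
  generalize e 0 = a at hbal ⊢
  generalize e 3 = b at hbal ⊢
  revert a b
  decide

/-- **Character lemma, minimal `Γ′ = (ℤ/3)³`** (`{ν₁ν₂ν₃ = 1} × {ν₄ν₆ = 1, ν₅ = 1}`): a balanced `e : Fin 6 → Fin 3` constant on `{0,1,2}`
and with `e 3 = e 5` (entry `4` free) is `0`, `v₀` or `−v₀`. [folklore] -/
theorem weilCharacter_of_blockConstant' (e : Fin 6 → Fin 3)
    (hbal : (Finset.univ.filter fun i => e i = 1).card = (Finset.univ.filter fun i => e i = 2).card)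
    (h01 : e 0 = e 1) (h12 : e 1 = e 2) (h35 : e 3 = e 5) :
    e = ![0, 0, 0, 0, 0, 0] ∨ e = ![1, 1, 1, 2, 2, 2] ∨ e = ![2, 2, 2, 1, 1, 1] := by
  have he : e = ![e 0, e 0, e 0, e 3, e 4, e 3] := by
    funext i
    fin_cases i
    · simp
    · simp [← h01]
    · simp [← h12, ← h01]
    · simp
    · simp
    · simp [← h35]
  rw [he] at hbal ⊢
  generalize e 0 = a at hbal ⊢
  generalize e 3 = b at hbal ⊢
  generalize e 4 = c at hbal ⊢
  revert a b c
  decide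

end Summit.HodgeConjecture.HodgeConjecture.WeilTypeLadder
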